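import Summits.ResolutionOfSingularities.ResolutionOfSingularities.Theorems.FrobeniusLadderFInjectiveMacaulayficationFCentreE1ChartWitness
import Summits.ResolutionOfSingularities.ResolutionOfSingularities.Theorems.FrobeniusLadderFInjectiveMacaulayficationClauseLocalizesScheme
import Summits.ResolutionOfSingularities.ResolutionOfSingularities.Theorems.FrobeniusLadderFInjectiveMacaulayficationFTemkinClosedPoints
import Mathlib.RingTheory.Ideal.KrullsHeightTheorem
import Mathlib.RingTheory.Ideal.MinimalPrime.Localization
import Mathlib.Algebra.MvPolynomial.Division
import Mathlib.Algebra.DualNumber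
import HarnessLib

/-!
# F4POS-1 (i): THE FIRST FLOOR OF THE τ-TOWER OF P2d4C IS NON-FULL ALONG A 3-DIMENSIONAL LOCUS — at the generic point and at EVERY point of `V(x, z′)`
# (crux `FInjectiveMacaulayfication` stmt-ResolutionOfSingularities-15315, chain w45a; res-L1-w45a-plan-1 RULING R18.4 (1) «F4POS-1 = the first F(4)-pos kernel
# facts, kernel shadow of TAU-PROBE (T2)»; seat res-L1-w45a-stub-2 g7)

[OURS · L1 W4.5a] Support file (`--supports stmt-ResolutionOfSingularities-15315 --as helper`); def-free, unconditional; replaces the role of NO printed item;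
NOT a statement of the manuscript; AI-written (AI review is weaker than expert review).

SETTING. `C′ = k[x,y,u,t,z′]/(f′)`, `f′ = z′² + x²z′ + x²(y³+u³+t³)` (`X 0 = x`, `X 1..3 = y,u,t`, `X 4 = z′`), `char k = 2` — res-L1-w45a-stub-1's chart ring
`k[x,T]/(F′)` of p604021/p604690, i.e. the `D(x²)`-chart of `Bl_𝔮̄ X` for `X = V(z²+x⁴z+y³+u³+t³)`, `𝔮̄ = (x²,y,u,t,z) = τ(X)` (res-L1-w45a-plan-1 TAU-PROBE (T1)/(T2):
floor 1 of the test-ideal tower). Its singular locus is `E_red = V(x, z′)`, 3-dimensional.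
* §1 `𝔭 := (x̄, z̄′)` is the kernel of `C′ → k[X]` killing `x, z′` (a prime of height one): `sub_aeval_killXZ_mem`, `ker_killXZ_eq`, `primeXZ_isPrime`, `primeXZ_eq_span`,
  `height_primeXZ`.
* §2 ★ `not_fullCl_atPrime_primeXZ` — `¬ FullCl 2 (C′_𝔭)`: `dim C′_𝔭 = 1`, `(x̄)` is a system of parameters (`√(x̄) = 𝔭 C′_𝔭` since `z̄′² = x̄²·(−(z̄′+g))`), and
  `z̄′ ∈ (x̄)^F ∖ (x̄)` — the witness map `C′_𝔭 → F[ε]/(ε²)` (`F = Frac k[X]`; `x ↦ 0`, `z′ ↦ ε`) kills `(x̄)` but not `z̄′`.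
* §3 ★★ `not_fullCl_stalk_of_mem_VXZ` — **for EVERY point `v` of `Spec C′` with `x̄, z̄′ ∈ v` (closed or not, `k`-rational or not): `¬ FullCl 2 𝒪_{Spec C′, v}`** — FULL descends
  to generizations (`ClauseLocalizes.fiClause_of_specializes`), and the generic point `𝔭` of `V(x, z′)` is not FULL. This is the kernel form of «the F-half input
  `S′ = Bl_τ X` has a POSITIVE-DIMENSIONAL non-FULL locus» on its principal chart (TAU-PROBE (T2)); NOT claimed here: the scheme-level identification of `C′` with the chart,
  CM/admissibility of `S′`, the CI charts `D(y), D(u), D(t)` (res-L1-w45a-stub-1 F4POS-1 (c)).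
[folklore mathematics, OURS as a certificate; cite: Fedder1983, Prop. 1.7; Matsumura1987, Thm. 13.5 (Krull); Hartshorne1977, I Thm. 5.1]
-/

-- single-problem summit: the doubled namespace component is forced
set_option linter.dupNamespace false

noncomputable section

open AlgebraicGeometry CategoryTheory Literature.AlgebraicGeometry.Resolution TopologicalSpace IsLocalRing MvPolynomial DualNumber

namespace Summit.ResolutionOfSingularities.ResolutionOfSingularities.Theorems.FInjectiveMacaulayfication.TauFloorOneNotFull

open Summit.ResolutionOfSingularities.ResolutionOfSingularities.Theorems.FInjectiveMacaulayfication
open SliceableCentre FCentreE1ChartWitness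

/-! ## §1 The prime `𝔭 = (x̄, z̄′)` as a kernel -/

/-- The substitution killing `x = X 0` and `z′ = X 4`. [plumbing] -/
theorem killXZ_apply (k : Type) [Field k] (j : Fin 5) :
    aeval (fun i : Fin 5 => if i = 0 ∨ i = 4 then (0 : MvPolynomial (Fin 5) k) else X i) (X j : MvPolynomial (Fin 5) k) =
      if j = 0 ∨ j = 4 then 0 else X j := by
  rw [aeval_X]

/-- `q − q(x ↦ 0, z′ ↦ 0) ∈ (x, z′)` for every polynomial `q`. [folklore] -/
theorem sub_aeval_killXZ_mem (k : Type) [Field k] (q : MvPolynomial (Fin 5) k) :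
    q - aeval (fun i : Fin 5 => if i = 0 ∨ i = 4 then (0 : MvPolynomial (Fin 5) k) else X i) q ∈
      Ideal.span ({X 0, X 4} : Set (MvPolynomial (Fin 5) k)) := by
  induction q using MvPolynomial.induction_on with
  | C a => rw [MvPolynomial.algHom_C]; simp
  | add p q hp hq =>
    rw [map_add, show p + q - (aeval _ p + aeval _ q) = (p - aeval _ p) + (q - aeval _ q) by ring]
    exact Ideal.add_mem _ hp hq
  | mul_X p i hp =>
    rw [map_mul, killXZ_apply]
    by_cases hi : i = 0 ∨ i = 4
    · rw [if_pos hi, mul_zero, sub_zero]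
      refine Ideal.mul_mem_left _ _ (Ideal.subset_span ?_)
      rcases hi with rfl | rfl
      · exact Or.inl rfl
      · exact Or.inr rfl
    · rw [if_neg hi, show p * X i - aeval _ p * X i = (p - aeval _ p) * X i by ring]
      exact Ideal.mul_mem_right _ _ hp

/-- `f′ = z′² + x²z′ + x²(y³+u³+t³)` dies under `x, z′ ↦ 0`. [plumbing] -/
theorem aeval_killXZ_chart (k : Type) [Field k] (F' : MvPolynomial (Fin 5) k)
    (hF : F' = X 4 ^ 2 + X 0 ^ 2 * X 4 + X 0 ^ 2 * (X 1 ^ 3 + X 2 ^ 3 + X 3 ^ 3)) :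
    aeval (fun i : Fin 5 => if i = 0 ∨ i = 4 then (0 : MvPolynomial (Fin 5) k) else X i) F' = 0 := by
  rw [hF]
  simp only [map_add, map_mul, map_pow, killXZ_apply]
  simp

/-- The kernel of `x, z′ ↦ 0` on `k[X]` is `(x, z′)`. [folklore] -/
theorem ker_killXZ_eq (k : Type) [Field k] :
    RingHom.ker (aeval (fun i : Fin 5 => if i = 0 ∨ i = 4 then (0 : MvPolynomial (Fin 5) k) else X i)).toRingHom =
      Ideal.span ({X 0, X 4} : Set (MvPolynomial (Fin 5) k)) := by
  apply le_antisymm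
  · intro q hq
    rw [RingHom.mem_ker] at hq
    have h := sub_aeval_killXZ_mem k q
    change q - (aeval _).toRingHom q ∈ _ at h
    rwa [hq, sub_zero] at h
  · rw [Ideal.span_le]
    rintro q hq
    rw [SetLike.mem_coe, RingHom.mem_ker]
    rcases hq with rfl | rfl
    · change aeval _ (X 0) = 0
      rw [killXZ_apply]; simp
    · change aeval _ (X 4) = 0
      rw [killXZ_apply]; simp

/-- The induced map `C′ = k[X]/(f′) → k[X]` (kill `x, z′`). [plumbing] -/
theorem exists_lift_killXZ (k : Type) [Field k] (F' : MvPolynomial (Fin 5) k)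
    (hF : F' = X 4 ^ 2 + X 0 ^ 2 * X 4 + X 0 ^ 2 * (X 1 ^ 3 + X 2 ^ 3 + X 3 ^ 3)) :
    ∃ Ψ : (MvPolynomial (Fin 5) k ⧸ Ideal.span {F'}) →+* MvPolynomial (Fin 5) k,
      ∀ q, Ψ (Ideal.Quotient.mk (Ideal.span {F'}) q) =
        aeval (fun i : Fin 5 => if i = 0 ∨ i = 4 then (0 : MvPolynomial (Fin 5) k) else X i) q := by
  refine ⟨Ideal.Quotient.lift (Ideal.span {F'})
    (aeval (fun i : Fin 5 => if i = 0 ∨ i = 4 then (0 : MvPolynomial (Fin 5) k) else X i)).toRingHom ?_, fun q => ?_⟩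
  · intro a ha
    obtain ⟨c, rfl⟩ := Ideal.mem_span_singleton.mp ha
    change aeval _ (F' * c) = 0
    rw [map_mul, aeval_killXZ_chart k F' hF, zero_mul]
  · exact Ideal.Quotient.lift_mk _ _ _

/-- ★ **`(x̄, z̄′)` IS A PRIME OF `C′`**: it is the kernel of `C′ → k[X]`, `x, z′ ↦ 0` (a map onto a domain). [folklore] -/
theorem primeXZ_isPrime (k : Type) [Field k] (F' : MvPolynomial (Fin 5) k)
    (hF : F' = X 4 ^ 2 + X 0 ^ 2 * X 4 + X 0 ^ 2 * (X 1 ^ 3 + X 2 ^ 3 + X 3 ^ 3)) :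
    (Ideal.span ({Ideal.Quotient.mk (Ideal.span {F'}) (X 0), Ideal.Quotient.mk (Ideal.span {F'}) (X 4)} :
      Set (MvPolynomial (Fin 5) k ⧸ Ideal.span {F'}))).IsPrime := by
  obtain ⟨Ψ, hΨ⟩ := exists_lift_killXZ k F' hF
  have hker : RingHom.ker Ψ = Ideal.span {Ideal.Quotient.mk (Ideal.span {F'}) (X 0), Ideal.Quotient.mk (Ideal.span {F'}) (X 4)} := by
    apply le_antisymm
    · intro r hr
      obtain ⟨q, rfl⟩ := Ideal.Quotient.mk_surjective r
      rw [RingHom.mem_ker, hΨ] at hr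
      have hq : q ∈ Ideal.span ({X 0, X 4} : Set (MvPolynomial (Fin 5) k)) := by
        rw [← ker_killXZ_eq]; exact hr
      have := Ideal.mem_map_of_mem (Ideal.Quotient.mk (Ideal.span {F'})) hq
      rwa [Ideal.map_span, Set.image_pair] at this
    · rw [Ideal.span_le]
      rintro r hr
      rw [SetLike.mem_coe, RingHom.mem_ker]
      rcases hr with rfl | rfl
      · rw [hΨ, killXZ_apply]; simp
      · rw [hΨ, killXZ_apply]; simp
  rw [← hker]
  exact RingHom.ker_isPrime Ψ

/-! ## §2 The local ring at `𝔭` is one-dimensional and NOT FULL -/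

/-- In `C′`: `z̄′² = x̄² · (−(z̄′ + (ȳ³+ū³+t̄³)))`. [folklore] -/
theorem sq_z_eq (k : Type) [Field k] (F' : MvPolynomial (Fin 5) k)
    (hF : F' = X 4 ^ 2 + X 0 ^ 2 * X 4 + X 0 ^ 2 * (X 1 ^ 3 + X 2 ^ 3 + X 3 ^ 3)) :
    Ideal.Quotient.mk (Ideal.span {F'}) (X 4) ^ 2 =
      Ideal.Quotient.mk (Ideal.span {F'}) (X 0) ^ 2 *
        Ideal.Quotient.mk (Ideal.span {F'}) (-(X 4 + (X 1 ^ 3 + X 2 ^ 3 + X 3 ^ 3))) := by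
  have hF0 : Ideal.Quotient.mk (Ideal.span {F'}) F' = 0 := Ideal.Quotient.eq_zero_iff_mem.mpr (Ideal.mem_span_singleton_self F')
  have e : (X 4 : MvPolynomial (Fin 5) k) ^ 2 = X 0 ^ 2 * (-(X 4 + (X 1 ^ 3 + X 2 ^ 3 + X 3 ^ 3))) + F' := by rw [hF]; ring
  have := congrArg (Ideal.Quotient.mk (Ideal.span {F'})) e
  rwa [map_add, hF0, add_zero, map_pow, map_mul, map_pow] at this

/-- `x̄` is a NON-ZERO-DIVISOR of `C′`: `x` is prime in `k[X]` and does not divide `f′` (`f′(0,0,0,0,1) = 1`). [folklore] -/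
theorem mk_X0_mem_nonZeroDivisors (k : Type) [Field k] (F' : MvPolynomial (Fin 5) k)
    (hF : F' = X 4 ^ 2 + X 0 ^ 2 * X 4 + X 0 ^ 2 * (X 1 ^ 3 + X 2 ^ 3 + X 3 ^ 3)) :
    Ideal.Quotient.mk (Ideal.span {F'}) (X 0) ∈ nonZeroDivisors (MvPolynomial (Fin 5) k ⧸ Ideal.span {F'}) := by
  rw [mem_nonZeroDivisors_iff_right]
  intro c hc
  obtain ⟨q, rfl⟩ := Ideal.Quotient.mk_surjective c
  rw [← map_mul, Ideal.Quotient.eq_zero_iff_mem, Ideal.mem_span_singleton] at hc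
  obtain ⟨d, hd⟩ := hc
  have hX : (X 0 : MvPolynomial (Fin 5) k) ∣ F' * d := ⟨q, by rw [← hd, mul_comm]⟩
  rcases (MvPolynomial.X_prime : Prime (X (0 : Fin 5) : MvPolynomial (Fin 5) k)).dvd_or_dvd hX with h | h
  · -- `x ∣ f′` is absurd: evaluate at `(0,0,0,0,1)`
    exfalso
    obtain ⟨e, he⟩ := h
    have := congrArg (MvPolynomial.eval (Pi.single 4 1 : Fin 5 → k)) he
    rw [hF] at this
    simp at this
  · obtain ⟨d', rfl⟩ := h
    rw [Ideal.Quotient.eq_zero_iff_mem, Ideal.mem_span_singleton]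
    refine ⟨d', mul_left_cancel₀ (X_ne_zero (0 : Fin 5) : (X 0 : MvPolynomial (Fin 5) k) ≠ 0) ?_⟩
    rw [mul_comm (X 0) q, hd]
    ring

/-- The height of `𝔭 = (x̄, z̄′)` is one: it is minimal over the principal ideal `(x̄)` (Krull) and non-zero in a domain. [cite: Matsumura1987, Thm. 13.5] -/
theorem height_primeXZ (k : Type) [Field k] (F' : MvPolynomial (Fin 5) k)
    (hF : F' = X 4 ^ 2 + X 0 ^ 2 * X 4 + X 0 ^ 2 * (X 1 ^ 3 + X 2 ^ 3 + X 3 ^ 3)) :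
    (Ideal.span ({Ideal.Quotient.mk (Ideal.span {F'}) (X 0), Ideal.Quotient.mk (Ideal.span {F'}) (X 4)} :
      Set (MvPolynomial (Fin 5) k ⧸ Ideal.span {F'}))).height = 1 := by
  haveI h𝔭 := primeXZ_isPrime k F' hF
  set R := MvPolynomial (Fin 5) k ⧸ Ideal.span {F'}
  set x : R := Ideal.Quotient.mk (Ideal.span {F'}) (X 0) with hx
  set z : R := Ideal.Quotient.mk (Ideal.span {F'}) (X 4) with hz
  set 𝔭 : Ideal R := Ideal.span {x, z} with h𝔭def
  haveI : (Ideal.span {x}).IsPrincipal := ⟨⟨x, rfl⟩⟩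
  have hmin : 𝔭 ∈ (Ideal.span {x}).minimalPrimes := by
    refine ⟨⟨h𝔭, ?_⟩, ?_⟩
    · rw [Ideal.span_singleton_le_iff_mem]; exact Ideal.subset_span (Or.inl rfl)
    · rintro q ⟨hq, hxq⟩ hq𝔭
      rw [Ideal.span_singleton_le_iff_mem] at hxq
      have hzq : z ∈ q := by
        apply hq.mem_of_pow_mem 2
        rw [hz, sq_z_eq k F' hF]
        exact Ideal.mul_mem_right _ _ (Ideal.pow_mem_of_mem _ hxq 2 (by norm_num))
      rw [h𝔭def, Ideal.span_le]
      rintro r hr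
      rcases hr with rfl | rfl
      · exact hxq
      · exact hzq
  refine le_antisymm (Ideal.height_le_one_of_isPrincipal_of_mem_minimalPrimes (Ideal.span {x}) 𝔭 hmin) ?_
  rw [Order.one_le_iff_ne_zero, Ne, Ideal.height_eq_zero_iff]
  intro hmin0
  exact notMem_nonZeroDivisors_of_mem_mem_minimalPrimes (Ideal.subset_span (Or.inl rfl) : x ∈ 𝔭) hmin0
    (mk_X0_mem_nonZeroDivisors k F' hF)

set_option maxHeartbeats 800000 in
-- one localization lift into `Frac(k[X])[ε]` + several ideal-membership computations (same budget as `FCentreE1ChartWitness.not_fullCl_chartOrigin`)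
/-- ★ **`¬ FullCl 2 (C′_𝔭)` AT THE GENERIC POINT `𝔭 = (x̄, z̄′)` OF `E_red`**: `dim C′_𝔭 = 1`, `(x̄)` is a system of parameters of `C′_𝔭` (`√(x̄) ∋ z̄′`), `z̄′² ∈ (x̄)^{[2]}`,
but `z̄′ ∉ (x̄) C′_𝔭` — the map `C′_𝔭 → F[ε]`, `F = Frac k[X]`, `x ↦ 0`, `z′ ↦ ε`, `y,u,t ↦ y,u,t`, kills `(x̄)` and sends `z̄′` to `ε ≠ 0` (elements off `𝔭` go to units:
their image under `x, z′ ↦ 0` is a non-zero first component). So clause 3 of `FullCl 2` fails — over ANY field `k` (no characteristic hypothesis is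
needed for this local statement; `z̄′² = x̄²·(−(z̄′+g))` holds identically). [cite: Fedder1983, Prop. 1.7 (context)] -/
theorem not_fullCl_atPrime_primeXZ (k : Type) [Field k] (F' : MvPolynomial (Fin 5) k)
    (hF : F' = X 4 ^ 2 + X 0 ^ 2 * X 4 + X 0 ^ 2 * (X 1 ^ 3 + X 2 ^ 3 + X 3 ^ 3))
    (Q : Ideal (MvPolynomial (Fin 5) k ⧸ Ideal.span {F'})) [Q.IsPrime]
    (hQ : Q = Ideal.span {Ideal.Quotient.mk (Ideal.span {F'}) (X 0), Ideal.Quotient.mk (Ideal.span {F'}) (X 4)}) :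
    ¬ FullCl 2 (Localization.AtPrime Q) := by
  classical
  intro hfull
  set R := MvPolynomial (Fin 5) k ⧸ Ideal.span {F'} with hR
  set mk : MvPolynomial (Fin 5) k →+* R := Ideal.Quotient.mk (Ideal.span {F'}) with hmk
  set L := Localization.AtPrime Q with hL
  set alg : R →+* L := algebraMap R L with halg
  -- (1) the dimension
  have hdim : ringKrullDim L = (1 : ℕ) := by
    rw [IsLocalization.AtPrime.ringKrullDim_eq_height Q L, hQ, height_primeXZ k F' hF]
    rfl
  -- (2) the system of parameters `s = (x̄)`
  set s : Fin 1 → L := fun _ => alg (mk (X 0)) with hs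
  have hx0 : alg (mk (X 0)) ∈ Ideal.span (Set.range s) := Ideal.subset_span ⟨0, rfl⟩
  have hz2 : alg (mk (X 4)) ^ 2 = alg (mk (X 0)) ^ 2 * alg (mk (-(X 4 + (X 1 ^ 3 + X 2 ^ 3 + X 3 ^ 3)))) := by
    rw [← map_pow, hmk, sq_z_eq k F' hF, map_mul, map_pow]
  have hz2mem : alg (mk (X 4)) ^ 2 ∈ Ideal.span (Set.range s) := by
    rw [hz2, pow_two, mul_assoc]
    exact Ideal.mul_mem_right _ _ hx0
  have hmaxL : IsLocalRing.maximalIdeal L = Q.map alg := (Localization.AtPrime.map_eq_maximalIdeal (I := Q)).symm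
  have hle : Ideal.span (Set.range s) ≤ IsLocalRing.maximalIdeal L := by
    rw [Ideal.span_le]
    rintro _ ⟨j, rfl⟩
    rw [hmaxL]
    refine Ideal.mem_map_of_mem _ ?_
    rw [hQ]
    exact Ideal.subset_span (Or.inl rfl)
  have hrad_eq : (Ideal.span (Set.range s)).radical = IsLocalRing.maximalIdeal L := by
    apply le_antisymm
    · exact (Ideal.radical_mono hle).trans_eq (IsLocalRing.maximalIdeal.isMaximal L).isPrime.radical
    · rw [hmaxL]
      refine Ideal.map_le_iff_le_comap.mpr fun q hq => ?_
      have hq' : q ∈ Ideal.span ({mk (X 0), mk (X 4)} : Set R) := hQ ▸ hq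
      refine (Ideal.span_le.mpr ?_) hq'
      rintro r hr
      rw [SetLike.mem_coe, Ideal.mem_comap]
      rcases hr with rfl | rfl
      · exact Ideal.le_radical hx0
      · exact ⟨2, hz2mem⟩
  have hrad : (Ideal.span (Set.range s)).radical.IsMaximal := by
    rw [hrad_eq]; exact IsLocalRing.maximalIdeal.isMaximal L
  -- (3) clause 3 of `FullCl 2` at `y = z̄′`, `e = 1`
  obtain ⟨-, hclause⟩ := hfull
  have hF3 := (hclause 1 hdim s hrad).2 (alg (mk (X 4))) ⟨1, by
    rw [pow_one, hz2]
    exact Ideal.mul_mem_right _ _ (Ideal.subset_span ⟨alg (mk (X 0)), hx0, by simp⟩)⟩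
  -- (4) `z̄′ ∉ (x̄) C′_𝔭`: evaluate into the dual numbers over `F = Frac k[X]`
  let Fr := FractionRing (MvPolynomial (Fin 5) k)
  let ι : MvPolynomial (Fin 5) k →+* Fr := algebraMap _ _
  let f : k →+* Fr[ε] := (TrivSqZeroExt.inlHom Fr Fr).comp (ι.comp MvPolynomial.C)
  let v : Fin 5 → Fr[ε] := fun j => if j = 4 then ε else if j = 0 then 0 else TrivSqZeroExt.inl (ι (X j))
  have hφF : eval₂Hom f v F' = 0 := by
    rw [hF]
    simp only [map_add, map_mul, map_pow, eval₂Hom_X', v, if_true, show (0 : Fin 5) ≠ 4 by decide, if_false, DualNumber.eps_pow_two,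
      zero_pow two_ne_zero, zero_mul, add_zero]
  let φ₁ : R →+* Fr[ε] := Ideal.Quotient.lift (Ideal.span {F'}) (eval₂Hom f v) fun a ha => by
    obtain ⟨c, rfl⟩ := Ideal.mem_span_singleton.mp ha
    rw [map_mul, hφF, zero_mul]
  have hφ₁ : ∀ g : MvPolynomial (Fin 5) k, φ₁ (mk g) = eval₂Hom f v g := fun g => Ideal.Quotient.lift_mk _ _ _
  -- the first component of `eval₂Hom f v` is `ι ∘ (x, z′ ↦ 0)`
  have hfst : ∀ g : MvPolynomial (Fin 5) k, TrivSqZeroExt.fst (eval₂Hom f v g) =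
      ι (aeval (fun i : Fin 5 => if i = 0 ∨ i = 4 then (0 : MvPolynomial (Fin 5) k) else X i) g) := by
    intro g
    have hcomp : (TrivSqZeroExt.fstHom Fr Fr Fr).toRingHom.comp (eval₂Hom f v) =
        ι.comp (aeval (fun i : Fin 5 => if i = 0 ∨ i = 4 then (0 : MvPolynomial (Fin 5) k) else X i)).toRingHom := by
      refine MvPolynomial.ringHom_ext (fun a => ?_) (fun j => ?_)
      · simp [f, TrivSqZeroExt.inlHom]
      · fin_cases j <;> simp [v]
    have h1 := RingHom.congr_fun hcomp g
    change TrivSqZeroExt.fst (eval₂Hom f v g) = ι (aeval _ g) at h1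
    exact h1
  have hunit : ∀ y : Q.primeCompl, IsUnit (φ₁ y) := by
    rintro ⟨y, hy⟩
    obtain ⟨g, rfl⟩ := Ideal.Quotient.mk_surjective y
    change IsUnit (φ₁ (mk g))
    rw [hφ₁, TrivSqZeroExt.isUnit_iff_isUnit_fst, hfst, isUnit_iff_ne_zero]
    intro hc
    apply hy
    -- `ι (kill g) = 0` ⇒ `kill g = 0` ⇒ `g ∈ (x, z′)` ⇒ `mk g ∈ Q`
    have hc' : aeval (fun i : Fin 5 => if i = 0 ∨ i = 4 then (0 : MvPolynomial (Fin 5) k) else X i) g = 0 :=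
      (IsFractionRing.injective (MvPolynomial (Fin 5) k) Fr) (by rw [map_zero]; exact hc)
    have hg : g ∈ Ideal.span ({X 0, X 4} : Set (MvPolynomial (Fin 5) k)) := by
      rw [← ker_killXZ_eq]; exact hc'
    have := Ideal.mem_map_of_mem mk hg
    rw [Ideal.map_span, Set.image_pair] at this
    change mk g ∈ Q
    rw [hQ]; exact this
  let ψ : L →+* Fr[ε] := IsLocalization.lift (M := Q.primeCompl) (g := φ₁) hunit
  have hψ : ∀ r : R, ψ (alg r) = φ₁ r := fun r => IsLocalization.lift_eq (M := Q.primeCompl) hunit r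
  -- `ψ` kills `(s) = (x̄)` …
  have hψs : ∀ w ∈ Ideal.span (Set.range s), ψ w = 0 := by
    intro w hw
    have hmap : Ideal.span (Set.range s) ≤ RingHom.ker ψ := by
      rw [Ideal.span_le]
      rintro _ ⟨j, rfl⟩
      rw [SetLike.mem_coe, RingHom.mem_ker, hs]
      change ψ (alg (mk (X 0))) = 0
      rw [hψ, hφ₁, eval₂Hom_X']
      simp [v]
    exact hmap hw
  -- … but not `z̄′ ↦ ε`
  have hε : ψ (alg (mk (X 4))) = ε := by
    rw [hψ, hφ₁, eval₂Hom_X']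
    simp [v]
  have h0 := hψs _ hF3
  rw [hε] at h0
  have := congrArg TrivSqZeroExt.snd h0
  rw [DualNumber.snd_eps, TrivSqZeroExt.snd_zero] at this
  exact one_ne_zero this

/-! ## §3 ★★ Every point of `V(x, z′) ⊂ Spec C′` is a NON-FULL point -/

/-- ★★ **THE FIRST FLOOR OF THE τ-TOWER OF P2d4C IS NON-FULL AT EVERY POINT OF THE 3-DIMENSIONAL LOCUS `V(x̄, z̄′)`** (closed or not, rational or not): FULL
descends to generizations (`ClauseLocalizes.fiClause_of_specializes`) and the generic point `(x̄, z̄′)` of the locus is not FULL (§2). In census words (OURS,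
counted 0): the principal chart of `S′ = Bl_{τ(X)} X`, `X = V(z²+x⁴z+y³+u³+t³)`, carries a POSITIVE-DIMENSIONAL non-FULL locus — a concrete F(4)-pos configuration
(res-L1-w45a-plan-1 TAU-PROBE (T2)); the scheme-level identification with the chart of `Bl_τ X` is not claimed here. [OURS · certificate; cite: Fedder1983, Prop. 1.7] -/
theorem not_fullCl_stalk_of_mem_VXZ (k : Type) [Field k] [CharP k 2] (F' : MvPolynomial (Fin 5) k)
    (hF : F' = X 4 ^ 2 + X 0 ^ 2 * X 4 + X 0 ^ 2 * (X 1 ^ 3 + X 2 ^ 3 + X 3 ^ 3))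
    (w : Spec (.of (MvPolynomial (Fin 5) k ⧸ Ideal.span {F'})))
    (hx : Ideal.Quotient.mk (Ideal.span {F'}) (X 0) ∈ w.asIdeal) (hz : Ideal.Quotient.mk (Ideal.span {F'}) (X 4) ∈ w.asIdeal) :
    ¬ FullCl 2 ((Spec (.of (MvPolynomial (Fin 5) k ⧸ Ideal.span {F'}))).presheaf.stalk w) := by
  haveI : Fact (Nat.Prime 2) := ⟨Nat.prime_two⟩
  haveI h𝔭 := primeXZ_isPrime k F' hF
  intro hw
  -- the generic point `η = 𝔭` of `V(x̄, z̄′)` specialises to `w`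
  let η : Spec (.of (MvPolynomial (Fin 5) k ⧸ Ideal.span {F'})) :=
    ⟨Ideal.span {Ideal.Quotient.mk (Ideal.span {F'}) (X 0), Ideal.Quotient.mk (Ideal.span {F'}) (X 4)}, h𝔭⟩
  have hle : η.asIdeal ≤ w.asIdeal := by
    change Ideal.span _ ≤ w.asIdeal
    rw [Ideal.span_le]
    rintro r hr
    rcases hr with rfl | rfl
    · exact hx
    · exact hz
  have hηw : η ⤳ w := (PrimeSpectrum.le_iff_specializes _ _).mp ((PrimeSpectrum.asIdeal_le_asIdeal _ _).mp hle)
  haveI : CharP ((Spec (.of (MvPolynomial (Fin 5) k ⧸ Ideal.span {F'}))).presheaf.stalk w) 2 :=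
    FTemkinClosedPoints.charP_stalk_of_over 2 (Spec.map (CommRingCat.ofHom (algebraMap k (MvPolynomial (Fin 5) k ⧸ Ideal.span {F'}))))
      (𝟙 _) w
  have hη := ClauseLocalizes.fiClause_of_specializes 2 hηw hw
  -- the stalk at `η` is `C′_𝔭`
  have hL : FullCl 2 (Localization.AtPrime η.asIdeal) :=
    WFixAtNonClosedDimTwo.fullCl_of_ringEquiv 2 (Spec.stalkIso (.of _) η).commRingCatIsoToRingEquiv hη
  exact not_fullCl_atPrime_primeXZ k F' hF η.asIdeal rfl hL

end Summit.ResolutionOfSingularities.ResolutionOfSingularities.Theorems.FInjectiveMacaulayfication.TauFloorOneNotFull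

end
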